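import Mathlib
import Literature.Geometry.DiscreteGeometry.MultiregularPointSystems

/-!
# Coaxial collapse, part A: affine-isometry algebra, translation vectors, cocompactness

Helper file A for the stub `stub_finitePointGroup` (Bieberbach I for a Delone set `D ⊆ ℝ³` with
finitely many symmetry orbits: the point group `{g.linearIsometryEquiv | g '' D = D}` is finite) of the
line `Sketch` of the crux `IsometryAtoms.AtomicLawChargesCrystal` (stmt-AtomisticToContinuum-15778).

Contents (all elementary, over Mathlib's `AffineIsometryEquiv` group on `EuclideanSpace ℝ (Fin 3)` and
`Delone.DeloneSet`):

* linear parts of products / inverses (`fpg_lin_mul`, `fpg_lin_inv`), the base-point formula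
  `g x = g.linearIsometryEquiv (x - q) + g q` (`fpg_apply_eq`, `fpg_map_sub`, `fpg_map_add`);
* the symmetry "group" `{g | g '' s = s}` is closed under `*` and `⁻¹` (`fpg_sym_mul`, `fpg_sym_inv`,
  `fpg_sym_mem_iff`);
* translation vectors `v` of a set `s` (rendered as `∀ x, x ∈ s ↔ x + v ∈ s`): closure under negation,
  addition, under the linear part of a symmetry (conjugation `g τ_v g⁻¹ = τ_{g.linear v}`), the translation
  vector `g q - q` of a symmetry with trivial linear part, and discreteness for a Delone set
  (`‖v‖ ≤ packingRadius ⇒ v = 0`);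
* small linear algebra of near-identity linear isometries (`fpg_small_half`, `fpg_small_tenth`,
  `fpg_fixed_of_smul`: a `1/2`-small isometry has no eigenvalue `≠ 1`; `fpg_unit_smul`,
  `fpg_inner_sub_fixed`: `B y - y ⊥ u` when `B u = u`; `fpg_smul_coeff_eq_zero`);
* step B1 of the coaxial collapse (`fpg_exists_small`): an infinite point group contains, for every
  `ε > 0`, a nontrivial `ε`-small linear part `A⁻¹B` (from the accumulation hypothesis T0);
* cocompactness of `Sym(D) · q₀` from finitely many orbits (`fpg_cocompact`).

No new definitions, no notation; the registered packaging theorem `fpg_subgoalA_cocompact` closes the file.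
-/

namespace Summit.AtomisticToContinuum.Crystallization.Theorems.IsometryAtomsAtomicLawChargesCrystal

open Metric

section Algebra

variable (g h : EuclideanSpace ℝ (Fin 3) ≃ᵃⁱ[ℝ] EuclideanSpace ℝ (Fin 3))

/-- The linear part of a product of affine isometries is the composite of the linear parts. -/
theorem fpg_lin_mul (v : EuclideanSpace ℝ (Fin 3)) :
    (g * h).linearIsometryEquiv v = g.linearIsometryEquiv (h.linearIsometryEquiv v) := by
  have h1 := (g * h).map_vsub v 0
  have h2 := g.map_vsub (h v) (h 0)
  have h3 := h.map_vsub v 0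
  simp only [vsub_eq_sub, sub_zero, AffineIsometryEquiv.coe_mul, Function.comp_apply] at h1 h2 h3
  rw [h1, ← h2, ← h3]

/-- The linear part of the inverse of an affine isometry is the inverse of its linear part. -/
theorem fpg_lin_inv (v : EuclideanSpace ℝ (Fin 3)) :
    (g⁻¹).linearIsometryEquiv v = g.linearIsometryEquiv.symm v := rfl

/-- `g.linear` and `g.linearIsometryEquiv` agree pointwise. -/
theorem fpg_linear_apply (v : EuclideanSpace ℝ (Fin 3)) : g.linear v = g.linearIsometryEquiv v := rfl

/-- Differences of values are the linear part applied to the difference. -/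
theorem fpg_map_sub (x y : EuclideanSpace ℝ (Fin 3)) : g x - g y = g.linearIsometryEquiv (x - y) := by
  have := g.map_vsub x y
  simp only [vsub_eq_sub] at this
  exact this.symm

/-- `g (v + p) = g.linear v + g p`. -/
theorem fpg_map_add (v p : EuclideanSpace ℝ (Fin 3)) : g (v + p) = g.linearIsometryEquiv v + g p := by
  have := g.map_vadd p v
  simp only [vadd_eq_add] at this
  exact this

/-- Base-point formula: `g x = g.linear (x - q) + g q`. -/
theorem fpg_apply_eq (x q : EuclideanSpace ℝ (Fin 3)) : g x = g.linearIsometryEquiv (x - q) + g q := by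
  rw [← fpg_map_sub]; abel

/-- An affine isometry with trivial linear part is the translation by `g q - q`. -/
theorem fpg_eq_add_of_lin_id (hlin : ∀ v : EuclideanSpace ℝ (Fin 3), g.linearIsometryEquiv v = v)
    (q x : EuclideanSpace ℝ (Fin 3)) : g x = x + (g q - q) := by
  rw [fpg_apply_eq g x q, hlin]; abel

/-- Symmetries of a set are closed under products. -/
theorem fpg_sym_mul {s : Set (EuclideanSpace ℝ (Fin 3))} (hg : g '' s = s) (hh : h '' s = s) :
    (g * h) '' s = s := by
  rw [AffineIsometryEquiv.coe_mul, Set.image_comp, hh, hg]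

/-- Symmetries of a set are closed under inverses. -/
theorem fpg_sym_inv {s : Set (EuclideanSpace ℝ (Fin 3))} (hg : g '' s = s) : ⇑(g⁻¹) '' s = s := by
  conv_lhs => rw [← hg]
  rw [Set.image_image]
  simp

/-- A symmetry `g` of `s` satisfies `g x ∈ s ↔ x ∈ s`. -/
theorem fpg_sym_mem_iff {s : Set (EuclideanSpace ℝ (Fin 3))} (hg : g '' s = s)
    (x : EuclideanSpace ℝ (Fin 3)) : g x ∈ s ↔ x ∈ s := by
  constructor
  · intro hx
    rw [← hg] at hx
    obtain ⟨y, hy, hyx⟩ := hx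
    rwa [← g.injective hyx]
  · intro hx
    rw [← hg]
    exact Set.mem_image_of_mem _ hx

end Algebra

section Translations

variable (g : EuclideanSpace ℝ (Fin 3) ≃ᵃⁱ[ℝ] EuclideanSpace ℝ (Fin 3))

/-- The translation vector `g q - q` of a symmetry with trivial linear part is a translation vector of
the set. -/
theorem fpg_transl_of_lin_id {s : Set (EuclideanSpace ℝ (Fin 3))} (hg : g '' s = s)
    (hlin : ∀ v : EuclideanSpace ℝ (Fin 3), g.linearIsometryEquiv v = v) (q : EuclideanSpace ℝ (Fin 3)) :
    ∀ x : EuclideanSpace ℝ (Fin 3), x ∈ s ↔ x + (g q - q) ∈ s := by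
  intro x
  rw [← fpg_eq_add_of_lin_id g hlin q x]
  exact (fpg_sym_mem_iff g hg x).symm

/-- Conjugation: the linear part of a symmetry maps translation vectors to translation vectors. -/
theorem fpg_transl_conj {s : Set (EuclideanSpace ℝ (Fin 3))} (hg : g '' s = s)
    {v : EuclideanSpace ℝ (Fin 3)} (hv : ∀ x : EuclideanSpace ℝ (Fin 3), x ∈ s ↔ x + v ∈ s) :
    ∀ x : EuclideanSpace ℝ (Fin 3), x ∈ s ↔ x + g.linearIsometryEquiv v ∈ s := by
  intro x
  have hx : g (g⁻¹ x) = x := by simp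
  calc x ∈ s ↔ g⁻¹ x ∈ s := by rw [← fpg_sym_mem_iff g hg (g⁻¹ x), hx]
    _ ↔ g⁻¹ x + v ∈ s := hv _
    _ ↔ g (g⁻¹ x + v) ∈ s := (fpg_sym_mem_iff g hg _).symm
    _ ↔ x + g.linearIsometryEquiv v ∈ s := by
      rw [add_comm (g⁻¹ x) v, fpg_map_add, hx, add_comm]

/-- Translation vectors are closed under negation. -/
theorem fpg_transl_neg {s : Set (EuclideanSpace ℝ (Fin 3))} {v : EuclideanSpace ℝ (Fin 3)}
    (hv : ∀ x : EuclideanSpace ℝ (Fin 3), x ∈ s ↔ x + v ∈ s) :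
    ∀ x : EuclideanSpace ℝ (Fin 3), x ∈ s ↔ x + -v ∈ s := by
  intro x
  have := hv (x + -v)
  rw [neg_add_cancel_right] at this
  exact this.symm

/-- Translation vectors are closed under addition. -/
theorem fpg_transl_add {s : Set (EuclideanSpace ℝ (Fin 3))} {v w : EuclideanSpace ℝ (Fin 3)}
    (hv : ∀ x : EuclideanSpace ℝ (Fin 3), x ∈ s ↔ x + v ∈ s)
    (hw : ∀ x : EuclideanSpace ℝ (Fin 3), x ∈ s ↔ x + w ∈ s) :
    ∀ x : EuclideanSpace ℝ (Fin 3), x ∈ s ↔ x + (v + w) ∈ s := by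
  intro x
  rw [hv x, hw (x + v), add_assoc]

/-- Discreteness of translation vectors of a Delone set: a translation vector not longer than the packing
radius vanishes. -/
theorem fpg_transl_eq_zero (D : Delone.DeloneSet (EuclideanSpace ℝ (Fin 3))) {v : EuclideanSpace ℝ (Fin 3)}
    (hv : ∀ x : EuclideanSpace ℝ (Fin 3),
      x ∈ (D : Set (EuclideanSpace ℝ (Fin 3))) ↔ x + v ∈ (D : Set (EuclideanSpace ℝ (Fin 3))))
    (hsmall : ‖v‖ ≤ D.packingRadius) : v = 0 := by
  by_contra hv0
  obtain ⟨q, hq⟩ := D.nonempty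
  have hq' : q + v ∈ (D : Set (EuclideanSpace ℝ (Fin 3))) := (hv q).1 hq
  have hne : q ≠ q + v := by
    intro h
    exact hv0 (left_eq_add.mp h)
  have hlt := D.packingRadius_lt_dist_of_mem_ne hq hq' hne
  rw [dist_eq_norm, sub_add_cancel_left, norm_neg] at hlt
  exact absurd hsmall (not_le.mpr hlt)

end Translations

section LinearAlgebra

/-- Smallness conversion: an `ε`-small isometry with `ε ≤ 1/2` is `1/2`-small. -/
theorem fpg_small_half {A : EuclideanSpace ℝ (Fin 3) ≃ₗᵢ[ℝ] EuclideanSpace ℝ (Fin 3)} {ε : ℝ}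
    (hε : ε ≤ 1 / 2) (h : ∀ x : EuclideanSpace ℝ (Fin 3), ‖A x - x‖ ≤ ε * ‖x‖) :
    ∀ x : EuclideanSpace ℝ (Fin 3), ‖A x - x‖ ≤ ‖x‖ / 2 := fun x =>
  (h x).trans (by nlinarith [norm_nonneg x])

/-- Smallness conversion: an `ε`-small isometry with `ε ≤ 1/10` is `1/10`-small. -/
theorem fpg_small_tenth {A : EuclideanSpace ℝ (Fin 3) ≃ₗᵢ[ℝ] EuclideanSpace ℝ (Fin 3)} {ε : ℝ}
    (hε : ε ≤ 1 / 10) (h : ∀ x : EuclideanSpace ℝ (Fin 3), ‖A x - x‖ ≤ ε * ‖x‖) :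
    ∀ x : EuclideanSpace ℝ (Fin 3), ‖A x - x‖ ≤ ‖x‖ / 10 := fun x =>
  (h x).trans (by nlinarith [norm_nonneg x])

/-- A `1/2`-small isometry has no eigenvalue `≠ 1`: if `B v = c • v` then `B v = v`. -/
theorem fpg_fixed_of_smul (B : EuclideanSpace ℝ (Fin 3) ≃ₗᵢ[ℝ] EuclideanSpace ℝ (Fin 3))
    (hB : ∀ x : EuclideanSpace ℝ (Fin 3), ‖B x - x‖ ≤ ‖x‖ / 2) {v : EuclideanSpace ℝ (Fin 3)} {c : ℝ}
    (h : B v = c • v) : B v = v := by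
  by_cases hv : v = 0
  · rw [hv, map_zero]
  have hn : 0 < ‖v‖ := norm_pos_iff.mpr hv
  have hc : |c| = 1 := by
    have h1 := B.norm_map v
    rw [h, norm_smul, Real.norm_eq_abs] at h1
    nlinarith [abs_nonneg c]
  rcases (abs_eq zero_le_one).mp hc with h1 | h1
  · rw [h, h1, one_smul]
  · exfalso
    have h2 := hB v
    have h3 : B v - v = (-2 : ℝ) • v := by rw [h, h1]; module
    rw [h3, norm_smul, Real.norm_eq_abs, abs_neg, abs_two] at h2
    linarith

/-- `‖c • u‖ = 1` with `‖u‖ = 1` forces `c = 1 ∨ c = -1`. -/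
theorem fpg_unit_smul {u : EuclideanSpace ℝ (Fin 3)} (hu : ‖u‖ = 1) {c : ℝ} (h : ‖c • u‖ = 1) :
    c = 1 ∨ c = -1 := by
  rw [norm_smul, hu, mul_one, Real.norm_eq_abs] at h
  exact (abs_eq zero_le_one).mp h

/-- For a linear isometry fixing `u`, every `B y - y` is orthogonal to `u`. -/
theorem fpg_inner_sub_fixed (B : EuclideanSpace ℝ (Fin 3) ≃ₗᵢ[ℝ] EuclideanSpace ℝ (Fin 3))
    {u : EuclideanSpace ℝ (Fin 3)} (hu : B u = u) (y : EuclideanSpace ℝ (Fin 3)) :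
    inner ℝ (B y - y) u = 0 := by
  rw [inner_sub_left, sub_eq_zero]
  calc inner ℝ (B y) u = inner ℝ (B y) (B u) := by rw [hu]
    _ = inner ℝ y u := B.inner_map_map y u

/-- A multiple `c • u` of a unit vector `u` orthogonal to `u` has `c = 0`. -/
theorem fpg_smul_coeff_eq_zero {u : EuclideanSpace ℝ (Fin 3)} (hu : ‖u‖ = 1) {c : ℝ}
    (h : inner ℝ (c • u) u = 0) : c = 0 := by
  rwa [real_inner_smul_left, real_inner_self_eq_norm_sq, hu, one_pow, mul_one] at h

/-- **Step B1.** If the point group `{g.linearIsometryEquiv | g '' s = s}` is infinite, then (by the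
accumulation hypothesis T0) for every `ε > 0` some symmetry `g = g_A⁻¹ g_B` of `s` has a nontrivial
`ε`-small linear part. -/
theorem fpg_exists_small
    (hT0 : ∀ S : Set (EuclideanSpace ℝ (Fin 3) ≃ₗᵢ[ℝ] EuclideanSpace ℝ (Fin 3)), S.Infinite → ∀ ε : ℝ,
      0 < ε → ∃ A ∈ S, ∃ B ∈ S, A ≠ B ∧ ∀ x : EuclideanSpace ℝ (Fin 3), ‖A x - B x‖ ≤ ε * ‖x‖)
    {s : Set (EuclideanSpace ℝ (Fin 3))}
    (hinf : {A : EuclideanSpace ℝ (Fin 3) ≃ₗᵢ[ℝ] EuclideanSpace ℝ (Fin 3) |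
      ∃ g : EuclideanSpace ℝ (Fin 3) ≃ᵃⁱ[ℝ] EuclideanSpace ℝ (Fin 3),
        g '' s = s ∧ g.linearIsometryEquiv = A}.Infinite)
    {ε : ℝ} (hε : 0 < ε) :
    ∃ g : EuclideanSpace ℝ (Fin 3) ≃ᵃⁱ[ℝ] EuclideanSpace ℝ (Fin 3), g '' s = s ∧
      (∃ x : EuclideanSpace ℝ (Fin 3), g.linearIsometryEquiv x ≠ x) ∧
        ∀ x : EuclideanSpace ℝ (Fin 3), ‖g.linearIsometryEquiv x - x‖ ≤ ε * ‖x‖ := by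
  obtain ⟨A, ⟨gA, hgA, rfl⟩, B, ⟨gB, hgB, rfl⟩, hAB, hclose⟩ := hT0 _ hinf ε hε
  refine ⟨gA⁻¹ * gB, fpg_sym_mul _ _ (fpg_sym_inv _ hgA) hgB, ?_, ?_⟩
  · by_contra hall
    push Not at hall
    apply hAB
    refine LinearIsometryEquiv.ext fun x => ?_
    have hx := hall x
    rw [fpg_lin_mul, fpg_lin_inv] at hx
    have h2 := congrArg gA.linearIsometryEquiv hx
    rw [LinearIsometryEquiv.apply_symm_apply] at h2
    exact h2.symm
  · intro x
    rw [fpg_lin_mul, fpg_lin_inv]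
    calc ‖gA.linearIsometryEquiv.symm (gB.linearIsometryEquiv x) - x‖
        = ‖gA.linearIsometryEquiv (gA.linearIsometryEquiv.symm (gB.linearIsometryEquiv x) - x)‖ :=
          (LinearIsometryEquiv.norm_map _ _).symm
      _ = ‖gA.linearIsometryEquiv x - gB.linearIsometryEquiv x‖ := by
          rw [map_sub, LinearIsometryEquiv.apply_symm_apply, norm_sub_rev]
      _ ≤ ε * ‖x‖ := hclose x

end LinearAlgebra

section Cocompact

/-- **Cocompactness from finitely many orbits.** If `Sym(D)` has finitely many orbits on the Delone set
`D`, then for any base point `q₀` the orbit `Sym(D) · q₀` is relatively dense: every `z` is within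
`R₁ := R_c + ∑_{s ∈ S} dist q₀ s` of some `g q₀` (`z` is `R_c`-close to some `x ∈ D`, `g x = s ∈ S` for a
symmetry `g`, and `dist (g⁻¹ q₀) x = dist q₀ s`). -/
theorem fpg_cocompact (D : Delone.DeloneSet (EuclideanSpace ℝ (Fin 3)))
    (hfin : Literature.Geometry.DiscreteGeometry.HasFinitelyManySymmetryOrbits
      (D : Set (EuclideanSpace ℝ (Fin 3))))
    (q₀ : EuclideanSpace ℝ (Fin 3)) :
    ∃ R₁ : ℝ, 0 ≤ R₁ ∧ ∀ z : EuclideanSpace ℝ (Fin 3),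
      ∃ g : EuclideanSpace ℝ (Fin 3) ≃ᵃⁱ[ℝ] EuclideanSpace ℝ (Fin 3),
        g '' (D : Set (EuclideanSpace ℝ (Fin 3))) = (D : Set (EuclideanSpace ℝ (Fin 3))) ∧
          dist (g q₀) z ≤ R₁ := by
  obtain ⟨S, hS⟩ := hfin
  refine ⟨(D.coveringRadius : ℝ) + ∑ s ∈ S, dist q₀ s, by positivity, fun z => ?_⟩
  obtain ⟨x, hx, hzx⟩ := D.exists_dist_le_coveringRadius z
  obtain ⟨g, hg, hgx⟩ := hS x hx
  refine ⟨g⁻¹, fpg_sym_inv g hg, ?_⟩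
  have h1 : dist (g⁻¹ q₀) x = dist q₀ (g x) := by
    rw [← g.dist_map (g⁻¹ q₀) x]
    simp [AffineIsometryEquiv.coe_inv]
  have h2 : dist q₀ (g x) ≤ ∑ s ∈ S, dist q₀ s :=
    Finset.single_le_sum (f := fun s => dist q₀ s) (fun _ _ => dist_nonneg) (Finset.mem_coe.mp hgx)
  calc dist (g⁻¹ q₀) z ≤ dist (g⁻¹ q₀) x + dist x z := dist_triangle _ _ _
    _ ≤ (∑ s ∈ S, dist q₀ s) + D.coveringRadius := by
      rw [h1, dist_comm x z]
      exact add_le_add h2 hzx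
    _ = (D.coveringRadius : ℝ) + ∑ s ∈ S, dist q₀ s := add_comm _ _

/-- **Registered sub-goal (helper file A) of `stub_finitePointGroup`: cocompactness of a symmetry orbit
of a Delone set with finitely many symmetry orbits.** -/
theorem fpg_subgoalA_cocompact : ∀ (D : Delone.DeloneSet (EuclideanSpace ℝ (Fin 3))) (q₀ : EuclideanSpace ℝ (Fin 3)), Literature.Geometry.DiscreteGeometry.HasFinitelyManySymmetryOrbits (D : Set (EuclideanSpace ℝ (Fin 3))) → ∃ R₁ : ℝ, 0 ≤ R₁ ∧ ∀ z : EuclideanSpace ℝ (Fin 3), ∃ g : EuclideanSpace ℝ (Fin 3) ≃ᵃⁱ[ℝ] EuclideanSpace ℝ (Fin 3), g '' (D : Set (EuclideanSpace ℝ (Fin 3))) = (D : Set (EuclideanSpace ℝ (Fin 3))) ∧ dist (g q₀) z ≤ R₁ :=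
  fun D q₀ hfin => fpg_cocompact D hfin q₀

end Cocompact

end Summit.AtomisticToContinuum.Crystallization.Theorems.IsometryAtomsAtomicLawChargesCrystal
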